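import Mathlib.RingTheory.KrullDimension.Regular
import Literature.RingTheory.TightClosure.RegularTightlyClosed
import HarnessLib

/-!
# Glassbrenner's elementwise criterion, quotient form (crux `FrobeniusLadder.FRationalResolution`, line `Sketch`)

Stub `stub_glassbrennerQuotient` (worker W1) of the skeleton `Sketch` for crux
stmt-ResolutionOfSingularities-15317: the abstract engine behind the suspension calibration
(`yz + f = 0` has all ideals of all its local rings tightly closed). Let `(S, 𝔪)` be a regular local
ring of prime characteristic `p` and `g ∈ S`.

* `mem_sup_span_of_mul_pow_mem` — the `S`-level step: if `c · g^(q-1) ∉ 𝔪^[q]` (`q = p^e`) then for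
  every ideal `J`, `c · y^q ∈ J^[q] + (g)` forces `y ∈ J + (g)`. Proof: with `I = J + (g)`, write
  `c y^q = j + a g`; then `c g^(q-1) y^q = g^(q-1) j + a g^q ∈ I^[q]`, so Kunz's flat colon
  (`mem_frobeniusPower_colon_of_isRegularLocalRing`, `I^[q] : y^q ⊆ (I : y)^[q]`) gives
  `c g^(q-1) ∈ (I : y)^[q]`; if `y ∉ I` then `(I : y) ⊆ 𝔪` and `c g^(q-1) ∈ 𝔪^[q]`.
* `stub_glassbrennerQuotient` — GLASSBRENNER'S ELEMENTWISE CRITERION in quotient form: if every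
  `c ∉ (g)` admits some `q = p^e` with `c · g^(q-1) ∉ 𝔪^[q]`, then every ideal `I` of `S/(g)` is
  tightly closed in the crux's inline sense (`c ≠ 0`, `c · y^(p^e) ∈ span {z^(p^e) | z ∈ I}` for all
  `e` `⇒ y ∈ I`). One exponent suffices: lift `c` to `c₀ ∉ (g)`, take `e` from the hypothesis, pull
  the membership back to `S` along `S → S/(g)` (the span of `p^e`-th powers of `I` is the image of
  `J^[p^e]`, `J` the preimage of `I`) and apply the `S`-level step.

This is the tight-closure twin of `Fedder.mem_sup_span_of_pow_mem` / `Fedder.frobeniusClosed_quotient`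
of the stmt-15315 line (Fedder's criterion in Frobenius-closure form), with an extra multiplier `c`;
only Kunz's theorem (flatness of Frobenius on a regular local ring) is used, no F-finiteness.

References: [Glassbrenner1996] D. Glassbrenner, Strong F-regularity in images of regular rings,
Proc. AMS 124 (1996), Thm. 2.3 (the elementwise criterion); [Fedder1983] R. Fedder, F-purity and
rational singularity, Trans. AMS 278 (1983), Prop. 1.7; [HunekeSwanson2006] Thm. 13.1.2 (6) and its
proof (Kunz's colon identity).
-/

-- single-problem summit: the doubled namespace component is forced
set_option linter.dupNamespace false

namespace Summit.ResolutionOfSingularities.ResolutionOfSingularities.Theorems.FRationalResolution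

open IsLocalRing Literature.RingTheory.TightClosure

/-- **The `S`-level step of Glassbrenner's criterion.** In a regular local ring `(S, 𝔪)` of
characteristic `p`, let `q = p^e` and suppose `c · g^(q-1) ∉ 𝔪^[q]`. Then for every ideal `J`:
`c · y^q ∈ J^[q] + (g)` implies `y ∈ J + (g)`. Proof: with `I = J + (g)`,
`c g^(q-1) y^q ∈ J^[q] + (g^q) ⊆ I^[q]`, so by Kunz's flat colon `c g^(q-1) ∈ (I : y)^[q]`; if
`y ∉ I` then `(I : y) ⊆ 𝔪` and `c g^(q-1) ∈ 𝔪^[q]`, a contradiction. -/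
theorem mem_sup_span_of_mul_pow_mem {S : Type*} [CommRing S] (p : ℕ) [Fact p.Prime] [CharP S p]
    [IsRegularLocalRing S] {g c : S} (e : ℕ)
    (hc : c * g ^ (p ^ e - 1) ∉ frobeniusPower (p ^ e) (maximalIdeal S))
    (J : Ideal S) {y : S} (hy : c * y ^ p ^ e ∈ frobeniusPower (p ^ e) J ⊔ Ideal.span {g}) :
    y ∈ J ⊔ Ideal.span {g} := by
  set I : Ideal S := J ⊔ Ideal.span {g} with hI
  by_contra hyI
  have hq0 : p ^ e ≠ 0 := pow_ne_zero e (Fact.out : p.Prime).ne_zero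
  obtain ⟨j, hj, a', ha', hja⟩ := Submodule.mem_sup.mp hy
  obtain ⟨a, rfl⟩ := Ideal.mem_span_singleton'.mp ha'
  have hgI : g ∈ I := Ideal.mem_sup_right (Ideal.mem_span_singleton_self g)
  -- `c g^(q-1) y^q ∈ I^[q]`
  have h1 : c * g ^ (p ^ e - 1) * y ^ p ^ e ∈ frobeniusPower (p ^ e) I := by
    have h2 : c * g ^ (p ^ e - 1) * y ^ p ^ e = g ^ (p ^ e - 1) * j + a * g ^ p ^ e := by
      calc c * g ^ (p ^ e - 1) * y ^ p ^ e = g ^ (p ^ e - 1) * (c * y ^ p ^ e) := by ring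
        _ = g ^ (p ^ e - 1) * (j + a * g) := by rw [hja]
        _ = g ^ (p ^ e - 1) * j + a * (g ^ (p ^ e - 1) * g) := by ring
        _ = g ^ (p ^ e - 1) * j + a * g ^ p ^ e := by rw [pow_sub_one_mul hq0]
    rw [h2]
    exact add_mem (Ideal.mul_mem_left _ _ (frobeniusPower_mono (p ^ e) le_sup_left hj))
      (Ideal.mul_mem_left _ _ (pow_mem_frobeniusPower hgI))
  -- Kunz: `c g^(q-1) ∈ (I : y)^[q]`
  have h3 : c * g ^ (p ^ e - 1) ∈ frobeniusPower (p ^ e) (I.colon {y}) :=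
    mem_frobeniusPower_colon_of_isRegularLocalRing p e h1
  have hne : I.colon {y} ≠ ⊤ := by
    intro htop
    have h1' : (1 : S) ∈ I.colon {y} := htop ▸ Submodule.mem_top
    rw [Submodule.mem_colon_singleton, one_smul] at h1'
    exact hyI h1'
  exact hc (frobeniusPower_mono (p ^ e) (le_maximalIdeal hne) h3)

/-- **Glassbrenner's elementwise criterion, quotient form.** `(S, 𝔪)` regular local of
characteristic `p`, `g ∈ S`. If every `c ∉ (g)` admits `q = p^e` with `c · g^(q-1) ∉ 𝔪^[q]`, then
every ideal `I` of `S/(g)` is tightly closed in the inline sense of crux `FRationalResolution`: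
`c ≠ 0` and `c · y^(p^e) ∈ span {z^(p^e) | z ∈ I}` for all `e` force `y ∈ I`. Proof (one `e`
suffices): lift `c` to `c₀ ∉ (g)`, get `e`; with `J` the preimage of `I` (so `(g) ⊆ J`) the span of
`p^e`-th powers of `I` is the image of `J^[p^e]`, hence a lift `y₀` of `y` has
`c₀ y₀^(p^e) ∈ J^[p^e] + (g)`, and `mem_sup_span_of_mul_pow_mem` gives `y₀ ∈ J + (g) = J`. -/
theorem stub_glassbrennerQuotient (p : ℕ) [Fact p.Prime] (S : Type) [CommRing S]
    [IsRegularLocalRing S] [CharP S p] (g : S)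
    (hG : ∀ c : S, c ∉ Ideal.span {g} → ∃ e : ℕ,
      c * g ^ (p ^ e - 1) ∉ frobeniusPower (p ^ e) (IsLocalRing.maximalIdeal S))
    (I : Ideal (S ⧸ Ideal.span {g})) (y c : S ⧸ Ideal.span {g}) (hc : c ≠ 0)
    (hy : ∀ e : ℕ, c * y ^ p ^ e ∈
      Ideal.span ((fun z : S ⧸ Ideal.span {g} => z ^ p ^ e) '' (I : Set (S ⧸ Ideal.span {g})))) :
    y ∈ I := by
  set mk := Ideal.Quotient.mk (Ideal.span {g}) with hmk
  obtain ⟨y₀, rfl⟩ := Ideal.Quotient.mk_surjective y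
  obtain ⟨c₀, rfl⟩ := Ideal.Quotient.mk_surjective c
  have hc₀ : c₀ ∉ Ideal.span {g} := fun h => hc (Ideal.Quotient.eq_zero_iff_mem.mpr h)
  obtain ⟨e, he⟩ := hG c₀ hc₀
  set J : Ideal S := I.comap mk with hJ
  -- the span of `p^e`-th powers of `I` lies in the image of `J^[p^e]`
  have hspan : Ideal.span ((fun z : S ⧸ Ideal.span {g} => z ^ p ^ e) '' (I : Set (S ⧸ Ideal.span {g})))
      ≤ (frobeniusPower (p ^ e) J).map mk := by
    rw [Ideal.span_le]
    rintro _ ⟨z, hz, rfl⟩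
    obtain ⟨z₀, rfl⟩ := Ideal.Quotient.mk_surjective z
    have hz₀ : z₀ ∈ J := Ideal.mem_comap.mpr hz
    change mk z₀ ^ p ^ e ∈ (frobeniusPower (p ^ e) J).map mk
    rw [← map_pow]
    exact Ideal.mem_map_of_mem mk (pow_mem_frobeniusPower hz₀)
  -- pull back to `S`: `c₀ y₀^(p^e) ∈ J^[p^e] + (g)`
  have h1 : c₀ * y₀ ^ p ^ e ∈ frobeniusPower (p ^ e) J ⊔ Ideal.span {g} := by
    have h2 : c₀ * y₀ ^ p ^ e ∈ ((frobeniusPower (p ^ e) J).map mk).comap mk := by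
      rw [Ideal.mem_comap, map_mul, map_pow]
      exact hspan (hy e)
    rwa [Ideal.comap_map_of_surjective mk Ideal.Quotient.mk_surjective, ← RingHom.ker_eq_comap_bot,
      Ideal.mk_ker] at h2
  have h3 : y₀ ∈ J ⊔ Ideal.span {g} := mem_sup_span_of_mul_pow_mem p e he J h1
  -- `g ∈ J`, so `J + (g) = J`
  have hgJ : Ideal.span {g} ≤ J := by
    rw [Ideal.span_singleton_le_iff_mem, hJ, Ideal.mem_comap, hmk,
      Ideal.Quotient.eq_zero_iff_mem.mpr (Ideal.mem_span_singleton_self g)]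
    exact I.zero_mem
  rw [sup_eq_left.mpr hgJ] at h3
  exact Ideal.mem_comap.mp h3

end Summit.ResolutionOfSingularities.ResolutionOfSingularities.Theorems.FRationalResolution
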